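import Mathlib
import Literature.Computability.Complexity.FourierTails
import Literature.NumberTheory.Sieve.MoebiusWalshCircuitsGreenProofs
import Summits.QuantumAdvantage.QuantumAdvantage.Theorems.MobiusLadderWalshLiouvilleBound
import Summits.QuantumAdvantage.QuantumAdvantage.Theorems.MobiusLadderLiouvilleOrthogonalTC0StubLtfCore
import HarnessLib

/-!
# Crux `MobiusLadder.LiouvilleOrthogonalTC0` (stmt-QuantumAdvantage-1393), line `Sketch`, skeleton v8:
stub `stub_gelfondSmall_of_tail` (K1b) — small frequencies of the Gelfond sums from the uniform Walsh bound

The Gelfond sums `S_n(α) = Σ_{N<2ⁿ} λ(N) e(α s₂(N))` (`s₂` = binary digit sum) satisfy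
`|S_n(α)| ≤ 2ⁿ / n^B` for `|α| ≤ n^{a-1/2}` (some `a > 0`, every `B`, eventually in `n`).
Proof: split into real and imaginary parts `Σ_y λ(y) cos(2παs(y))`, `Σ_y λ(y) sin(2παs(y))` on the
cube; each is handled by Green's §2 splitting `GreenAC0.core_bound` with the empty and the small
Walsh characters bounded by Bourgain's uniform Walsh bound for `λ` (`WalshLiouvilleBound`, proved in
the tree) and the Fourier tail of the phase (hypothesis `hT`) at level `k + 1`, `k = ⌊n^{1/R}⌋₊`,
`R = ⌈3/c⌉₊`, `a = 1/(3R)`: then `n sin²(πα) ≤ π² n^{2a} ≤ (k+1)/4` and all three cost terms are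
`≤ 2ⁿ/(6 n^B)` eventually (exponential beats polynomial in `k`).
-/

set_option linter.dupNamespace false -- D-0017: single-problem summit ⇒ `QuantumAdvantage.QuantumAdvantage` by design

noncomputable section

namespace Summit.QuantumAdvantage.QuantumAdvantage.Theorems.LiouvilleOrthogonalTC0

open Filter Finset
open Literature.Computability.Complexity (bitsToNat)
open Literature.Computability.Complexity.LowDegree (tailWeight cubeFourierCoeff)
open Literature.Probability.RandomGraphs.LowDegree (sgn walsh)

/-- Exponential beats polynomial: for `1 < r`, eventually in `k`, `C · (k+1)^M ≤ r^(k+1)`. [folklore] -/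
theorem gelfondSmall_evt_poly_le_pow {r : ℝ} (hr : 1 < r) (C : ℝ) (M : ℕ) :
    ∀ᶠ k : ℕ in atTop, C * ((k : ℝ) + 1) ^ M ≤ r ^ (k + 1) := by
  have h := (tendsto_pow_const_div_const_pow_of_one_lt M hr).comp (tendsto_add_atTop_nat 1)
  have hpos : (0 : ℝ) < 1 / (|C| + 1) := by positivity
  filter_upwards [h.eventually_le_const hpos] with k hk
  have hrk : (0 : ℝ) < r ^ (k + 1) := pow_pos (by linarith) _
  simp only [Function.comp, Nat.cast_add, Nat.cast_one] at hk
  rw [div_le_iff₀ hrk] at hk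
  have hC1 : (0 : ℝ) < |C| + 1 := by positivity
  calc C * ((k : ℝ) + 1) ^ M ≤ (|C| + 1) * ((k : ℝ) + 1) ^ M := by
        gcongr; exact (le_abs_self C).trans (by linarith)
    _ ≤ (|C| + 1) * (1 / (|C| + 1) * r ^ (k + 1)) := mul_le_mul_of_nonneg_left hk hC1.le
    _ = r ^ (k + 1) := by field_simp

/-- One real phase: Green's §2 splitting with the uniform Walsh bound on the empty and the small
characters (`LtfCore.low_term_le`) and a tail `≤ η²` gives `|∑ G f| ≤ 3 η 2ⁿ`. -/
theorem gelfondSmall_real_bound {n k R : ℕ} {c η : ℝ} (hc : 0 < c) (hRc : 3 ≤ (R : ℝ) * c)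
    (hkn : k ^ R ≤ n) (hnk : n < (k + 1) ^ R) (hRk : R + 1 ≤ k) (hη0 : 0 ≤ η)
    (hηk : ((2 : ℝ)⁻¹) ^ k ≤ η)
    (f G : (Fin n → Bool) → ℝ) (hf : ∀ y, |f y| ≤ 1) (hG : ∀ y, |G y| ≤ 1)
    (hWalsh : ∀ A : Finset (Fin n), |∑ y, G y * walsh A y| ≤ (2 : ℝ) ^ ((n : ℝ) - (n : ℝ) ^ c))
    (hτ : tailWeight f (k + 1) ≤ η ^ 2) :
    |∑ y, G y * f y| ≤ 3 * η * 2 ^ n := by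
  set W : ℝ := (2 : ℝ) ^ ((n : ℝ) - (n : ℝ) ^ c) with hWdef
  have h0 : |∑ y, G y| ≤ W := by simpa using hWalsh ∅
  have hW0 : 0 ≤ W := by positivity
  have hcore := Literature.NumberTheory.Sieve.GreenAC0.core_bound (k := k) f G hf hG (E₀ := W)
    (E₁ := W) (τ := η ^ 2) hW0 h0 (fun S _ _ => hWalsh S) hτ
  refine hcore.trans ?_
  have hlow : ((n : ℝ) + 1) ^ k * W ≤ η * 2 ^ n := LtfCore.low_term_le hc hRc hkn hnk hRk hηk
  have hE0 : W ≤ η * 2 ^ n := by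
    refine le_trans ?_ hlow
    refine le_mul_of_one_le_left hW0 ?_
    exact one_le_pow₀ (by linarith [(Nat.cast_nonneg n : (0 : ℝ) ≤ n)])
  rw [Real.sqrt_sq hη0]
  linarith

/-- Real and imaginary parts of `Σ_y ℓ(y) e^{iθ(y)}` for an integer-valued `ℓ`. [folklore] -/
theorem gelfondSmall_re_im_sum {ι : Type*} (s : Finset ι) (ℓ : ι → ℤ) (θ : ι → ℝ) :
    (∑ y ∈ s, ((ℓ y : ℤ) : ℂ) * Complex.exp (((θ y : ℝ) : ℂ) * Complex.I)).re =
        ∑ y ∈ s, ((ℓ y : ℤ) : ℝ) * Real.cos (θ y) ∧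
      (∑ y ∈ s, ((ℓ y : ℤ) : ℂ) * Complex.exp (((θ y : ℝ) : ℂ) * Complex.I)).im =
        ∑ y ∈ s, ((ℓ y : ℤ) : ℝ) * Real.sin (θ y) := by
  refine ⟨?_, ?_⟩
  · rw [Complex.re_sum]
    refine Finset.sum_congr rfl fun y _ => ?_
    simp [Complex.mul_re, Complex.exp_ofReal_mul_I_re, Complex.exp_ofReal_mul_I_im]
  · rw [Complex.im_sum]
    refine Finset.sum_congr rfl fun y _ => ?_
    simp [Complex.mul_im, Complex.exp_ofReal_mul_I_re, Complex.exp_ofReal_mul_I_im]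

/-- **Small frequencies of the Gelfond sums** (registered stub `stub_gelfondSmall_of_tail`, K1b of
skeleton v8). Given the Fourier-tail bound `hT` for the phases `cos/sin(2πα s(y))` on the cube
(`s(y)` = Hamming weight), there is `a > 0` such that for every `B`, eventually in `n`, for all
`|α| ≤ n^{a-1/2}`, `|Σ_{N<2ⁿ} λ(N) e(α s₂(N))| ≤ 2ⁿ / n^B`. Proof: real/imaginary parts, the cube
reindexing `MoebiusWalsh.sum_range_two_pow_eq_sum_cube`, Green's §2 splitting
`GreenAC0.core_bound` with Bourgain's uniform Walsh bound `WalshLiouvilleBound` (exponent `c`) on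
the characters of size `≤ k = ⌊n^{1/R}⌋₊` (`R = ⌈3/c⌉₊`, `LtfCore.low_term_le`) and the tail
`exp(2n sin²(πα) - (k+1)) ≤ exp(-(k+1)/2)` for `a = 1/(3R)`. -/
theorem stub_gelfondSmall_of_tail
    (hT : ∀ (n m : ℕ) (α : ℝ),
      tailWeight (fun y : Fin n → Bool =>
          Real.cos (2 * Real.pi * α * ((Finset.univ.filter fun i : Fin n => y i = true).card : ℝ))) m
          ≤ Real.exp (2 * n * Real.sin (Real.pi * α) ^ 2 - m) ∧
        tailWeight (fun y : Fin n → Bool =>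
          Real.sin (2 * Real.pi * α * ((Finset.univ.filter fun i : Fin n => y i = true).card : ℝ))) m
          ≤ Real.exp (2 * n * Real.sin (Real.pi * α) ^ 2 - m)) :
    ∃ a : ℝ, 0 < a ∧ ∀ B : ℕ, ∀ᶠ n : ℕ in atTop, ∀ α : ℝ, |α| ≤ (n : ℝ) ^ (a - 1 / 2) →
      ‖∑ N ∈ Finset.range (2 ^ n), ((ArithmeticFunction.liouville N : ℤ) : ℂ) *
            Complex.exp (((2 * Real.pi * α *
              ((Finset.univ.filter fun i : Fin n => Nat.testBit N i = true).card : ℝ) : ℝ) : ℂ) * Complex.I)‖ ≤ (2 : ℝ) ^ n / (n : ℝ) ^ B := by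
  have hWLB := Summit.QuantumAdvantage.QuantumAdvantage.Theorems.MobiusLadder.walshLiouvilleBound_proof
  unfold Summit.QuantumAdvantage.QuantumAdvantage.Theses.MobiusLadder.WalshLiouvilleBound at hWLB
  obtain ⟨c, hc, hW⟩ := hWLB
  -- parameters
  set R : ℕ := ⌈(3 : ℝ) / c⌉₊ with hRdef
  have hR1 : 1 ≤ R := by
    have : (0 : ℝ) < 3 / c := by positivity
    exact Nat.one_le_iff_ne_zero.mpr (Nat.pos_iff_ne_zero.mp (Nat.ceil_pos.mpr this))
  have hRc : 3 ≤ (R : ℝ) * c := by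
    have h1 : (3 : ℝ) / c ≤ R := Nat.le_ceil _
    have := mul_le_mul_of_nonneg_right h1 hc.le
    rwa [div_mul_cancel₀ _ hc.ne'] at this
  have hRpos : (0 : ℝ) < R := by exact_mod_cast hR1
  set a : ℝ := 1 / (3 * R) with hadef
  have ha : 0 < a := by positivity
  refine ⟨a, ha, fun B => ?_⟩
  -- the eventual conditions
  have hk := LtfCore.tendsto_floor_rpow hR1
  have e1 : ∀ᶠ k : ℕ in atTop, R + 1 ≤ k := eventually_ge_atTop _
  have e2 : ∀ᶠ k : ℕ in atTop, 12 * ((k : ℝ) + 1) ^ (R * B) ≤ 2 ^ (k + 1) :=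
    gelfondSmall_evt_poly_le_pow one_lt_two _ _
  have e3 : ∀ᶠ k : ℕ in atTop, 36 * ((k : ℝ) + 1) ^ (R * B * 2) ≤ Real.exp (1 / 2) ^ (k + 1) :=
    gelfondSmall_evt_poly_le_pow (Real.one_lt_exp_iff.mpr (by norm_num)) _ _
  have e4 : ∀ᶠ n : ℕ in atTop, 4 * Real.pi ^ 2 ≤ (n : ℝ) ^ a := by
    have := ((tendsto_rpow_atTop ha).comp tendsto_natCast_atTop_atTop).eventually_ge_atTop
      (4 * Real.pi ^ 2)
    exact this.mono fun n hn => by simpa using hn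
  have e5 : ∀ᶠ n : ℕ in atTop, 1 ≤ n := eventually_ge_atTop 1
  filter_upwards [hW, hk.eventually (e1.and (e2.and e3)), e4, e5] with n hWn hpar h4 hn1 α hα
  obtain ⟨hRk, h2k, h3k⟩ := hpar
  set k : ℕ := ⌊((n : ℝ)) ^ ((1 : ℝ) / R)⌋₊ with hkdef
  have hn0 : (0 : ℝ) < n := by exact_mod_cast hn1
  have hnB : (0 : ℝ) < (n : ℝ) ^ B := pow_pos hn0 B
  have hkn : k ^ R ≤ n := LtfCore.floor_rpow_pow_le hR1 n
  have hnk : n < (k + 1) ^ R := LtfCore.lt_floor_rpow_succ_pow hR1 n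
  -- η = 1/(6 n^B)
  set η : ℝ := 1 / (6 * (n : ℝ) ^ B) with hηdef
  have hη0 : 0 < η := by positivity
  have hnB' : (n : ℝ) ^ B ≤ ((k : ℝ) + 1) ^ (R * B) := by
    have : n ^ B ≤ ((k + 1) ^ R) ^ B := Nat.pow_le_pow_left hnk.le B
    rw [← pow_mul] at this
    exact_mod_cast this
  have hηk : ((2 : ℝ)⁻¹) ^ k ≤ η := by
    rw [inv_pow, hηdef, one_div]
    refine inv_anti₀ (by positivity) ?_
    have h2 : (2 : ℝ) ^ (k + 1) = 2 * 2 ^ k := pow_succ' 2 k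
    rw [h2] at h2k
    nlinarith [hnB', h2k]
  have hτk : Real.exp (-(((k : ℝ) + 1) / 2)) ≤ η ^ 2 := by
    have hexp : Real.exp (1 / 2) ^ (k + 1) = Real.exp (((k : ℝ) + 1) / 2) := by
      rw [← Real.exp_nat_mul]; congr 1; push_cast; ring
    rw [hexp] at h3k
    have hsq : ((n : ℝ) ^ B) ^ 2 ≤ ((k : ℝ) + 1) ^ (R * B * 2) := by
      rw [pow_mul]; exact pow_le_pow_left₀ hnB.le hnB' 2
    rw [Real.exp_neg, hηdef, div_pow, one_pow, one_div]
    refine inv_anti₀ (by positivity) ?_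
    nlinarith [hsq, h3k]
  -- the phase bound: 2 n sin²(πα) ≤ (k+1)/2
  have hphase : 2 * (n : ℝ) * Real.sin (Real.pi * α) ^ 2 ≤ ((k : ℝ) + 1) / 2 := by
    have hs : Real.sin (Real.pi * α) ^ 2 ≤ (Real.pi * α) ^ 2 := Real.sin_sq_le_sq
    have hα2 : α ^ 2 ≤ ((n : ℝ) ^ (a - 1 / 2)) ^ 2 := by
      rw [← sq_abs α]
      exact pow_le_pow_left₀ (abs_nonneg α) hα 2
    have hpow : (n : ℝ) * ((n : ℝ) ^ (a - 1 / 2)) ^ 2 = (n : ℝ) ^ (2 * a) := by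
      rw [← Real.rpow_natCast ((n : ℝ) ^ (a - 1 / 2)) 2, ← Real.rpow_mul hn0.le]
      rw [show (n : ℝ) * (n : ℝ) ^ ((a - 1 / 2) * ((2 : ℕ) : ℝ)) =
          (n : ℝ) ^ (1 : ℝ) * (n : ℝ) ^ ((a - 1 / 2) * ((2 : ℕ) : ℝ)) by rw [Real.rpow_one]]
      rw [← Real.rpow_add hn0]
      congr 1; push_cast; ring
    have h1R : (n : ℝ) ^ ((1 : ℝ) / R) = (n : ℝ) ^ a * (n : ℝ) ^ (2 * a) := by
      rw [← Real.rpow_add hn0]; congr 1; rw [hadef]; field_simp; ring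
    have hk1 : (n : ℝ) ^ ((1 : ℝ) / R) < (k : ℝ) + 1 := by
      rw [hkdef]; exact Nat.lt_floor_add_one _
    have h2a0 : (0 : ℝ) ≤ (n : ℝ) ^ (2 * a) := Real.rpow_nonneg hn0.le _
    calc 2 * (n : ℝ) * Real.sin (Real.pi * α) ^ 2
        ≤ 2 * (n : ℝ) * (Real.pi * α) ^ 2 := by gcongr
      _ = 2 * Real.pi ^ 2 * ((n : ℝ) * α ^ 2) := by ring
      _ ≤ 2 * Real.pi ^ 2 * ((n : ℝ) * ((n : ℝ) ^ (a - 1 / 2)) ^ 2) := by gcongr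
      _ = 2 * Real.pi ^ 2 * (n : ℝ) ^ (2 * a) := by rw [hpow]
      _ = (4 * Real.pi ^ 2 * (n : ℝ) ^ (2 * a)) / 2 := by ring
      _ ≤ ((n : ℝ) ^ a * (n : ℝ) ^ (2 * a)) / 2 := by gcongr
      _ = (n : ℝ) ^ ((1 : ℝ) / R) / 2 := by rw [h1R]
      _ ≤ ((k : ℝ) + 1) / 2 := by gcongr
  -- the tail bound at level k+1 for both phases
  have htail : Real.exp (2 * n * Real.sin (Real.pi * α) ^ 2 - ((k + 1 : ℕ) : ℝ)) ≤ η ^ 2 := by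
    refine le_trans (Real.exp_le_exp.mpr ?_) hτk
    push_cast
    linarith
  obtain ⟨hTc, hTs⟩ := hT n (k + 1) α
  -- transfer of the Walsh bound to the cube
  set G : (Fin n → Bool) → ℝ := fun y =>
    ((ArithmeticFunction.liouville (bitsToNat (List.ofFn y)) : ℤ) : ℝ) with hGdef
  have hG : ∀ y, |G y| ≤ 1 := fun y =>
    Literature.NumberTheory.LFunctions.LiouvilleSum.abs_liouville_le_one _
  have hWalsh : ∀ A : Finset (Fin n), |∑ y, G y * walsh A y| ≤ (2 : ℝ) ^ ((n : ℝ) - (n : ℝ) ^ c) := by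
    intro A
    have h := hWn A
    rw [Literature.NumberTheory.Sieve.MoebiusWalsh.sum_range_two_pow_eq_sum_cube
      (fun N => ((ArithmeticFunction.liouville N : ℤ) : ℝ) *
        walsh A (fun i : Fin n => Nat.testBit N i))] at h
    simp only [Literature.NumberTheory.Sieve.MoebiusWalsh.ofFn_testBit_bitsToNat] at h
    exact h
  -- the phase
  set θ : (Fin n → Bool) → ℝ := fun y =>
    2 * Real.pi * α * ((Finset.univ.filter fun i : Fin n => y i = true).card : ℝ) with hθdef
  have hcos : |∑ y, G y * Real.cos (θ y)| ≤ 3 * η * 2 ^ n :=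
    gelfondSmall_real_bound hc hRc hkn hnk hRk hη0.le hηk (fun y => Real.cos (θ y)) G
      (fun y => Real.abs_cos_le_one _) hG hWalsh (hTc.trans htail)
  have hsin : |∑ y, G y * Real.sin (θ y)| ≤ 3 * η * 2 ^ n :=
    gelfondSmall_real_bound hc hRc hkn hnk hRk hη0.le hηk (fun y => Real.sin (θ y)) G
      (fun y => Real.abs_sin_le_one _) hG hWalsh (hTs.trans htail)
  -- pass to the cube and split into real and imaginary parts
  rw [Literature.NumberTheory.Sieve.MoebiusWalsh.sum_range_two_pow_eq_sum_cube
    (fun N => ((ArithmeticFunction.liouville N : ℤ) : ℂ) *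
      Complex.exp (((2 * Real.pi * α *
        ((Finset.univ.filter fun i : Fin n => Nat.testBit N i = true).card : ℝ) : ℝ) : ℂ) *
          Complex.I))]
  simp only [Literature.NumberTheory.Sieve.MoebiusWalsh.testBit_bitsToNat_ofFn]
  obtain ⟨hre, him⟩ := gelfondSmall_re_im_sum (Finset.univ : Finset (Fin n → Bool))
    (fun y => ArithmeticFunction.liouville (bitsToNat (List.ofFn y))) θ
  have h36 : 3 * η * 2 ^ n + 3 * η * 2 ^ n = (2 : ℝ) ^ n / (n : ℝ) ^ B := by
    rw [hηdef]; field_simp; ring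
  calc ‖∑ y : Fin n → Bool, ((ArithmeticFunction.liouville (bitsToNat (List.ofFn y)) : ℤ) : ℂ) *
          Complex.exp (((θ y : ℝ) : ℂ) * Complex.I)‖
      ≤ |(∑ y : Fin n → Bool, ((ArithmeticFunction.liouville (bitsToNat (List.ofFn y)) : ℤ) : ℂ) *
          Complex.exp (((θ y : ℝ) : ℂ) * Complex.I)).re| +
        |(∑ y : Fin n → Bool, ((ArithmeticFunction.liouville (bitsToNat (List.ofFn y)) : ℤ) : ℂ) *
          Complex.exp (((θ y : ℝ) : ℂ) * Complex.I)).im| := Complex.norm_le_abs_re_add_abs_im _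
    _ = |∑ y, G y * Real.cos (θ y)| + |∑ y, G y * Real.sin (θ y)| := by rw [hre, him]
    _ ≤ 3 * η * 2 ^ n + 3 * η * 2 ^ n := add_le_add hcos hsin
    _ = (2 : ℝ) ^ n / (n : ℝ) ^ B := h36

end Summit.QuantumAdvantage.QuantumAdvantage.Theorems.LiouvilleOrthogonalTC0
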